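import Summits.Ventures.HodgeRepro.FaceCensusEngine
import Summits.Ventures.HodgeRepro.EngineMasks
import Summits.Ventures.HodgeRepro.EngineFacesWF
import Summits.Ventures.HodgeRepro.EngineNormalize

/-!
# EngineCounts — closed formulas for `places.length` and `faces.length` (seat p4)

For every Cayley table `Γ` with the group axioms: `Γ.places.length = n / 2` (the places `{g, c g}` partition `G`
into pairs) and `Γ.faces.length = Γ.cmTypes.length * (Γ.places.length * (Γ.places.length - 1))` (faces are ORDERED
pairs of distinct places attached to a CM type).  (Part 4 of p4's generic engine lemmas.)
-/

namespace Summit.Ventures.HodgeRepro.FaceCensus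

/-- Removing one member from a duplicate-free list shortens it by exactly one. -/
theorem length_filter_bne_of_nodup {l : List ℕ} (hl : l.Nodup) {p : ℕ} (hp : p ∈ l) :
    (l.filter fun q => q != p).length = l.length - 1 := by
  have h := List.length_eq_countP_add_countP (fun q => q != p) (l := l)
  have hc : List.countP (fun a => decide ¬(a != p) = true) l = 1 := by
    have : (fun a : ℕ => decide ¬(a != p) = true) = fun a => a == p := by
      funext a
      by_cases h : a = p <;> simp [bne, h]
    rw [this]
    exact List.count_eq_one_of_mem hl hp
  rw [List.countP_eq_length_filter] at h
  omega

namespace CMGaloisType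

variable {n : ℕ} (Γ : CMGaloisType n)

/-- `places` has no duplicates (it is normalised). -/
theorem places_nodup : Γ.places.Nodup := normalize_nodup _

/-- **Count of faces**: `faces.length = cmTypes.length * (places.length * (places.length - 1))` — faces are ordered pairs of distinct places attached to a CM type. -/
theorem faces_length :
    Γ.faces.length = Γ.cmTypes.length * (Γ.places.length * (Γ.places.length - 1)) := by
  unfold faces
  rw [List.length_flatMap]
  have hinner : ∀ T : ℕ,
      (Γ.places.flatMap fun p => (Γ.places.filter fun q => q != p).map fun q => (T, p, q)).length =
        Γ.places.length * (Γ.places.length - 1) := by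
    intro T
    rw [List.length_flatMap]
    have : (Γ.places.map fun p => ((Γ.places.filter fun q => q != p).map fun q => (T, p, q)).length) =
        Γ.places.map fun _ => Γ.places.length - 1 := by
      apply List.map_congr_left
      intro p hp
      rw [List.length_map, length_filter_bne_of_nodup Γ.places_nodup hp]
    rw [this, List.map_const', List.sum_replicate, smul_eq_mul]
  simp only [hinner, List.map_const', List.sum_replicate, smul_eq_mul]

/-- The fibre of `placeMask` over the place of `a₀` is `{a₀, c a₀}`. -/
theorem placeMask_eq_iff (hΓ : Γ.isCMGaloisType = true) (a a₀ : Fin n) :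
    Γ.placeMask a = Γ.placeMask a₀ ↔ a = a₀ ∨ a = Γ.mul Γ.conj a₀ := by
  constructor
  · intro h
    have := Γ.mem_placeMask_self a
    rw [h, Γ.mem_placeMask, Bool.or_eq_true, decide_eq_true_eq, decide_eq_true_eq] at this
    exact this
  · rintro (rfl | rfl)
    · rfl
    · exact Γ.placeMask_conj hΓ a₀

/-- The finset of places is the image of `placeMask`. -/
theorem places_toFinset : Γ.places.toFinset = Finset.univ.image Γ.placeMask := by
  ext p
  simp [Γ.mem_places, eq_comm]

/-- **Count of places**: `places.length = n / 2` for every Cayley table with the group axioms (the places `{a, c a}` partition `Fin n` into pairs). -/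
theorem places_length (hΓ : Γ.isCMGaloisType = true) : Γ.places.length = n / 2 := by
  have hlen : Γ.places.length = (Finset.univ.image Γ.placeMask).card := by
    rw [← Γ.places_toFinset, List.toFinset_card_of_nodup Γ.places_nodup]
  have hsum : (Finset.univ : Finset (Fin n)).card =
      ∑ b ∈ Finset.univ.image Γ.placeMask, (Finset.univ.filter fun a => Γ.placeMask a = b).card :=
    Finset.card_eq_sum_card_fiberwise fun a _ => Finset.mem_image_of_mem _ (Finset.mem_univ a)
  have hfib : ∀ b ∈ Finset.univ.image Γ.placeMask, (Finset.univ.filter fun a => Γ.placeMask a = b).card = 2 := by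
    intro b hb
    obtain ⟨a₀, -, rfl⟩ := Finset.mem_image.1 hb
    have : (Finset.univ.filter fun a => Γ.placeMask a = Γ.placeMask a₀) = {a₀, Γ.mul Γ.conj a₀} := by
      ext a
      simp [Γ.placeMask_eq_iff hΓ]
    rw [this, Finset.card_pair ((IsGroupTable.conj_mul_ne hΓ) a₀).symm]
  rw [Finset.sum_congr rfl hfib, Finset.sum_const, smul_eq_mul, Finset.card_univ, Fintype.card_fin] at hsum
  rw [hlen]
  omega

end CMGaloisType

end Summit.Ventures.HodgeRepro.FaceCensus
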